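import Summits.FinalStateConjecture.FinalStateConjecture.Statement
import Summits.FinalStateConjecture.FinalStateConjecture.Theorems.PhaseMixingCaptureCaptureSufficesC2StubSelfWitnesses
import Literature.Geometry.Lorentzian.TameBreathingCurve
import Literature.Geometry.Lorentzian.CauchyDevelopmentPrecomp
import Literature.Geometry.Lorentzian.AFEndUnbreathe
import Literature.Geometry.Lorentzian.TameGenericityDiagonal
import Literature.Geometry.Lorentzian.TameGenericityLocal
import HarnessLib

/-!
# `CaptureSufficesC2` (stmt-FinalStateConjecture-14986), line `censorship-enters-diagonally`:
# the SETTLING clause of the re-typed summit is invariant under re-indexing the data, and the full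
# summit property has tame SELF-WITNESSES (breathing curves)

`Literature/Geometry/Lorentzian/CauchyDevelopmentPrecomp.lean` (p129197) transports the
development-level clauses CENSORED / QUIET / MARGIN of the final-state layer along the re-indexing
`D ↦ Φ^* D` of the data by a diffeomorphism `Φ` of `X` (`VacuumCauchyDevelopment.precomp`: same
spacetime, embedding `ι ∘ Φ`). This file adds the last clause — the summit's SETTLING clause
(`C²` `FinalStateDecomposition` with sub-extremal holes, `O = exteriorOf 𝒟 d.charted`,
`RaysStayInClosure`, `HasExhaustiveCharts`, `IsFutureOriented`), whose only data-dependent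
ingredients are `range ι` (unchanged) and the family of normalised null rays from the points of the
data hypersurface (re-indexed by `Φ`) — and draws the consequence for the line: through every
admissible datum having the FULL summit property passes a tame, injective, immersed curve of
admissible data all having it (the breathing curve of `TameBreathingCurve.lean`, as for the quiet /
margin self-witnesses of `…StubSelfWitnesses.lean`, p129443). With it, the line's pointwise stub 4
(`stub_trackedCaptureSettles`: every tracked-with-margin MGHD settles) may be relaxed to a RELATIVE
form (settling kicks along margin curves) at the cost of one more application of the composition
lemma `isTameChristodoulouGeneric_of_relative'` — `summitCurveWitness_of_kick_and_self` below.

* `raysStayInClosure_precomp_iff`, `exteriorOf_precomp`, `settling_precomp_iff` — transport of the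
  settling clause along `precomp`;
* `summitClause_comap_iff` — the summit's per-datum matrix is invariant under `D ↦ Φ^* D`;
* `summit_breatheFamily`, `summitSelfWitness` — tame self-witnesses of the summit property;
* `summitCurveWitness_of_kick_and_self` — relative local settling kicks + self-witnesses give the
  curve witnesses the composition consumes; `finalStateConjecture_of_genericMargin_of_settlingKick`
  — the summit from tame-generic MARGIN and relative settling kicks.
-/

set_option linter.dupNamespace false

noncomputable section

open Set Function Filter
open scoped Manifold ContDiff Topology

namespace Summit.FinalStateConjecture.FinalStateConjecture.Theorems.PhaseMixingCaptureCaptureSufficesC2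

open Literature.Geometry.Lorentzian
open Summit.FinalStateConjecture (HasCompleteNullInfinity exteriorOf RaysStayInClosure HasExhaustiveCharts
  IsFutureOriented)

section Transport

variable {X : Type} [TopologicalSpace X] [ChartedSpace E3 X] [IsManifold (𝓡 3) ∞ X] [ConnectedSpace X]
  {D : InitialDataSet (𝓡 3) X} (𝒟 : VacuumCauchyDevelopment D) (Φ : X ≃ₜ X)
  (hΦ : ContMDiff (𝓡 3) (𝓡 3) (∞ + 1) Φ) (hΦ' : ∀ u, Injective (mfderiv (𝓡 3) (𝓡 3) Φ u))

/-- **`RaysStayInClosure` of the re-indexed development iff of the original** (same region `O`): the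
normalised null rays from `p` for `(ι ∘ Φ, ν ∘ Φ)` are the normalised null rays from `Φ p` for
`(ι, ν)`, and `Φ` is onto. [cite: DafermosLuk2017, Conjecture 1] -/
theorem raysStayInClosure_precomp_iff (O : Set 𝒟.carrier) :
    RaysStayInClosure (𝒟.precomp Φ hΦ hΦ').toCauchyDevelopment O ↔
      RaysStayInClosure 𝒟.toCauchyDevelopment O := by
  constructor
  · intro h inst p γ dom hγ hdom t ht ht0
    obtain ⟨q, rfl⟩ := Φ.surjective p
    haveI : (𝒟.precomp Φ hΦ hΦ').metric.HasLeviCivita := inst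
    exact h q γ dom hγ hdom t ht ht0
  · intro h inst q γ dom hγ hdom t ht ht0
    haveI : 𝒟.metric.HasLeviCivita := inst
    exact h (Φ q) γ dom hγ hdom t ht ht0

/-- **The exterior region determined by a late set is unchanged by re-indexing** (`range (ι ∘ Φ) =
range ι`). [folklore] -/
theorem exteriorOf_precomp (U : Set 𝒟.carrier) :
    exteriorOf (𝒟.precomp Φ hΦ hΦ').toCauchyDevelopment U = exteriorOf 𝒟.toCauchyDevelopment U := by
  show 𝒟.metric.causalFuture 𝒟.timeOrientation (range (𝒟.embed ∘ Φ)) ∩ _ = _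
  rw [Φ.surjective.range_comp]
  rfl

/-- **The settling clause of the re-typed summit transfers along `precomp`**: a `C²`
`FinalStateDecomposition` of the (common) spacetime with sub-extremal holes, `O = exteriorOf`,
rays staying in `closure O`, exhaustive and future-oriented charts, serves both developments.
[cite: DafermosLuk2017, Conjecture 1] -/
theorem settling_precomp_iff :
    (∃ (O : Set (𝒟.precomp Φ hΦ hΦ').carrier)
        (d : FinalStateDecomposition (𝒟.precomp Φ hΦ hΦ').toSpacetime O 2),
        (∀ i, Kerr.IsSubextremal (d.mass i) (d.spin i)) ∧
          O = exteriorOf (𝒟.precomp Φ hΦ hΦ').toCauchyDevelopment d.charted ∧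
            RaysStayInClosure (𝒟.precomp Φ hΦ hΦ').toCauchyDevelopment O ∧
              HasExhaustiveCharts d ∧ IsFutureOriented d) ↔
      ∃ (O : Set 𝒟.carrier) (d : FinalStateDecomposition 𝒟.toSpacetime O 2),
        (∀ i, Kerr.IsSubextremal (d.mass i) (d.spin i)) ∧
          O = exteriorOf 𝒟.toCauchyDevelopment d.charted ∧
            RaysStayInClosure 𝒟.toCauchyDevelopment O ∧ HasExhaustiveCharts d ∧ IsFutureOriented d := by
  constructor
  · rintro ⟨O, d, h₁, h₂, h₃, h₄, h₅⟩
    refine ⟨O, d, h₁, ?_, (raysStayInClosure_precomp_iff 𝒟 Φ hΦ hΦ' O).1 h₃, h₄, h₅⟩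
    rwa [exteriorOf_precomp] at h₂
  · rintro ⟨O, d, h₁, h₂, h₃, h₄, h₅⟩
    refine ⟨O, d, h₁, ?_, (raysStayInClosure_precomp_iff 𝒟 Φ hΦ hΦ' O).2 h₃, h₄, h₅⟩
    rwa [exteriorOf_precomp]

/-- **Complete `𝓘⁺` together with the settling clause transfers along `precomp`.** [folklore] -/
theorem cniSettling_precomp_iff :
    (HasCompleteNullInfinity (𝒟.precomp Φ hΦ hΦ').toCauchyDevelopment ∧
      ∃ (O : Set (𝒟.precomp Φ hΦ hΦ').carrier)
        (d : FinalStateDecomposition (𝒟.precomp Φ hΦ hΦ').toSpacetime O 2),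
        (∀ i, Kerr.IsSubextremal (d.mass i) (d.spin i)) ∧
          O = exteriorOf (𝒟.precomp Φ hΦ hΦ').toCauchyDevelopment d.charted ∧
            RaysStayInClosure (𝒟.precomp Φ hΦ hΦ').toCauchyDevelopment O ∧
              HasExhaustiveCharts d ∧ IsFutureOriented d) ↔
      HasCompleteNullInfinity 𝒟.toCauchyDevelopment ∧
        ∃ (O : Set 𝒟.carrier) (d : FinalStateDecomposition 𝒟.toSpacetime O 2),
          (∀ i, Kerr.IsSubextremal (d.mass i) (d.spin i)) ∧
            O = exteriorOf 𝒟.toCauchyDevelopment d.charted ∧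
              RaysStayInClosure 𝒟.toCauchyDevelopment O ∧ HasExhaustiveCharts d ∧
                IsFutureOriented d :=
  and_congr (𝒟.hasCompleteFutureNullInfinity_precomp_iff Φ hΦ hΦ') (settling_precomp_iff 𝒟 Φ hΦ hΦ')

/-- **The summit's per-datum matrix is invariant under re-indexing the data**: "`Φ^* D` has an MGHD
and every MGHD of `Φ^* D` has complete `𝓘⁺` and settles down" iff the same for `D` (`Φ` a
diffeomorphism: homeomorphism, smooth with injective differentials both ways).
[cite: ChoquetBruhatGeroch1969CMP, p. 330] -/
theorem summitClause_comap_iff (hΨ : ContMDiff (𝓡 3) (𝓡 3) (∞ + 1) Φ.symm)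
    (hΨ' : ∀ u, Injective (mfderiv (𝓡 3) (𝓡 3) Φ.symm u)) :
    ((∃ 𝒟' : VacuumCauchyDevelopment (D.comap Φ hΦ hΦ'), 𝒟'.IsMaximal) ∧
      ∀ 𝒟' : VacuumCauchyDevelopment (D.comap Φ hΦ hΦ'), 𝒟'.IsMaximal →
        HasCompleteNullInfinity 𝒟'.toCauchyDevelopment ∧
          ∃ (O : Set 𝒟'.carrier) (d : FinalStateDecomposition 𝒟'.toSpacetime O 2),
            (∀ i, Kerr.IsSubextremal (d.mass i) (d.spin i)) ∧
              O = exteriorOf 𝒟'.toCauchyDevelopment d.charted ∧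
                RaysStayInClosure 𝒟'.toCauchyDevelopment O ∧ HasExhaustiveCharts d ∧
                  IsFutureOriented d) ↔
    ((∃ 𝒟 : VacuumCauchyDevelopment D, 𝒟.IsMaximal) ∧
      ∀ 𝒟 : VacuumCauchyDevelopment D, 𝒟.IsMaximal →
        HasCompleteNullInfinity 𝒟.toCauchyDevelopment ∧
          ∃ (O : Set 𝒟.carrier) (d : FinalStateDecomposition 𝒟.toSpacetime O 2),
            (∀ i, Kerr.IsSubextremal (d.mass i) (d.spin i)) ∧
              O = exteriorOf 𝒟.toCauchyDevelopment d.charted ∧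
                RaysStayInClosure 𝒟.toCauchyDevelopment O ∧ HasExhaustiveCharts d ∧
                  IsFutureOriented d) := by
  refine and_congr (VacuumCauchyDevelopment.exists_isMaximal_comap_iff Φ hΦ hΦ' hΨ hΨ') ?_
  exact VacuumCauchyDevelopment.forall_isMaximal_comap_iff Φ hΦ hΦ' hΨ hΨ'
    (fun {D'} 𝒟 ↦ HasCompleteNullInfinity 𝒟.toCauchyDevelopment ∧
      ∃ (O : Set 𝒟.carrier) (d : FinalStateDecomposition 𝒟.toSpacetime O 2),
        (∀ i, Kerr.IsSubextremal (d.mass i) (d.spin i)) ∧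
          O = exteriorOf 𝒟.toCauchyDevelopment d.charted ∧
            RaysStayInClosure 𝒟.toCauchyDevelopment O ∧ HasExhaustiveCharts d ∧ IsFutureOriented d)
    fun 𝒟 Θ hΘ hΘ' ↦ cniSettling_precomp_iff 𝒟 Θ hΘ hΘ'

end Transport

section SelfWitness

variable {X : Type} [TopologicalSpace X] [ChartedSpace E3 X] [IsManifold (𝓡 3) ∞ X]
  [T2Space X] [ConnectedSpace X]
  {e : AFEnd X} {z₀ : E3} {r : ℝ} (B : AFEnd.BreathingData e z₀ r) (d : InitialDataSet (𝓡 3) X)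

/-- **The summit property passes from `d` to every member of its breathing family**
(`E_t = (breathe (σ t))^* d`, transferred by `summitClause_comap_iff`). [folklore] -/
theorem summit_breatheFamily (t : ℝ)
    (hP : (∃ 𝒟 : VacuumCauchyDevelopment d, 𝒟.IsMaximal) ∧
      ∀ 𝒟 : VacuumCauchyDevelopment d, 𝒟.IsMaximal →
        HasCompleteNullInfinity 𝒟.toCauchyDevelopment ∧
          ∃ (O : Set 𝒟.carrier) (dd : FinalStateDecomposition 𝒟.toSpacetime O 2),
            (∀ i, Kerr.IsSubextremal (dd.mass i) (dd.spin i)) ∧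
              O = exteriorOf 𝒟.toCauchyDevelopment dd.charted ∧
                RaysStayInClosure 𝒟.toCauchyDevelopment O ∧ HasExhaustiveCharts dd ∧
                  IsFutureOriented dd) :
    (∃ 𝒟 : VacuumCauchyDevelopment (AFEnd.breatheFamily B d t), 𝒟.IsMaximal) ∧
      ∀ 𝒟 : VacuumCauchyDevelopment (AFEnd.breatheFamily B d t), 𝒟.IsMaximal →
        HasCompleteNullInfinity 𝒟.toCauchyDevelopment ∧
          ∃ (O : Set 𝒟.carrier) (dd : FinalStateDecomposition 𝒟.toSpacetime O 2),
            (∀ i, Kerr.IsSubextremal (dd.mass i) (dd.spin i)) ∧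
              O = exteriorOf 𝒟.toCauchyDevelopment dd.charted ∧
                RaysStayInClosure 𝒟.toCauchyDevelopment O ∧ HasExhaustiveCharts dd ∧
                  IsFutureOriented dd := by
  set Φ : X ≃ₜ X := AFEnd.breatheHomeomorph B (AFEnd.abs_squash_lt_invScale B t) with hΦdef
  have hΦ : ContMDiff (𝓡 3) (𝓡 3) (∞ + 1) Φ :=
    AFEnd.contMDiff_breathe_succ B (AFEnd.abs_squash_lt_scale B t).2
  have hΦ' : ∀ u, Injective (mfderiv (𝓡 3) (𝓡 3) Φ u) :=
    (AFEnd.breatheScale_spec B).2.2 _ (AFEnd.abs_squash_lt_scale B t).1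
  have hΨ : ContMDiff (𝓡 3) (𝓡 3) (∞ + 1) Φ.symm := AFEnd.contMDiff_unbreathe B _
  have hΨ' : ∀ u, Injective (mfderiv (𝓡 3) (𝓡 3) Φ.symm u) :=
    injective_mfderiv_homeomorph_symm Φ hΦ hΨ
  have key : AFEnd.breatheFamily B d t = d.comap Φ hΦ hΦ' := rfl
  rw [key]
  exact (summitClause_comap_iff Φ hΦ hΦ' hΨ hΨ').2 hP

/-- **SELF-WITNESSES OF THE SUMMIT PROPERTY.** Through every admissible datum `d` having the full
per-datum property of the re-typed summit (an MGHD exists; every MGHD has complete `𝓘⁺` and settles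
down with sub-extremal holes, `O = exteriorOf`, `RaysStayInClosure`, exhaustive future-oriented
charts) passes a tame (on a collared restriction of the sole end of `d`), injective, immersed curve of
admissible data all having it: the breathing curve of `d`. The handed-over end `e` and the tameness of
the constant curve are not used (shape of the composition's self-witness hypothesis).
[cite: Christodoulou1999, p. A24] -/
theorem summitSelfWitness :
    ∀ (X : Type) [TopologicalSpace X] [ChartedSpace E3 X] [IsManifold (𝓡 3) ∞ X] [T2Space X]
      [SecondCountableTopology X] [ConnectedSpace X] (e : AFEnd X) (d : InitialDataSet (𝓡 3) X),
      InitialDataSet.IsTameDataFamily e 1 (fun _ : EuclideanSpace ℝ (Fin 1) ↦ d) →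
        d ∈ admissibleVacuumData X →
          ((∃ 𝒟 : VacuumCauchyDevelopment d, 𝒟.IsMaximal) ∧
            ∀ 𝒟 : VacuumCauchyDevelopment d, 𝒟.IsMaximal →
              HasCompleteNullInfinity 𝒟.toCauchyDevelopment ∧
                ∃ (O : Set 𝒟.carrier) (dd : FinalStateDecomposition 𝒟.toSpacetime O 2),
                  (∀ i, Kerr.IsSubextremal (dd.mass i) (dd.spin i)) ∧
                    O = exteriorOf 𝒟.toCauchyDevelopment dd.charted ∧
                      RaysStayInClosure 𝒟.toCauchyDevelopment O ∧ HasExhaustiveCharts dd ∧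
                        IsFutureOriented dd) →
          ∃ (e' : AFEnd X) (F' : EuclideanSpace ℝ (Fin 1) → InitialDataSet (𝓡 3) X),
            InitialDataSet.IsTameDataFamily e' 1 F' ∧ F' 0 = d ∧ Function.Injective F' ∧
              InitialDataSet.IsImmersedAtZero 1 F' ∧ (∀ c, F' c ∈ admissibleVacuumData X) ∧
              ∀ c : EuclideanSpace ℝ (Fin 1), c ≠ 0 →
                ((∃ 𝒟 : VacuumCauchyDevelopment (F' c), 𝒟.IsMaximal) ∧
                  ∀ 𝒟 : VacuumCauchyDevelopment (F' c), 𝒟.IsMaximal →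
                    HasCompleteNullInfinity 𝒟.toCauchyDevelopment ∧
                      ∃ (O : Set 𝒟.carrier) (dd : FinalStateDecomposition 𝒟.toSpacetime O 2),
                        (∀ i, Kerr.IsSubextremal (dd.mass i) (dd.spin i)) ∧
                          O = exteriorOf 𝒟.toCauchyDevelopment dd.charted ∧
                            RaysStayInClosure 𝒟.toCauchyDevelopment O ∧ HasExhaustiveCharts dd ∧
                              IsFutureOriented dd) := by
  intro X _ _ _ _ _ _ e d _ hd hP
  obtain ⟨-, e₀, M, hsole, hdecay⟩ := id hd
  set z₀ : E3 := (e₀.R + 3) • EuclideanSpace.single (0 : Fin 3) (1 : ℝ) with hz₀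
  have hz₀n : ‖z₀‖ = e₀.R + 3 := by
    rw [hz₀, norm_smul, PiLp.norm_single, norm_one, mul_one,
      Real.norm_of_nonneg (by linarith [e₀.R_pos])]
  have B : e₀.BreathingData z₀ 1 := ⟨one_pos, by rw [hz₀n]; linarith⟩
  have hR₁ : e₀.R < e₀.R + 1 := by linarith
  exact ⟨e₀.restrict hR₁.le, fun c ↦ AFEnd.breatheFamily B d (c 0),
    AFEnd.isTameDataFamily_restrict_breatheCurve B d hsole hdecay hR₁,
    AFEnd.breatheCurve_zero B d, AFEnd.injective_breatheCurve B d,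
    AFEnd.isImmersedAtZero_breatheCurve B d,
    fun c ↦ AFEnd.breatheCurve_mem_admissibleVacuumData B d hd c,
    fun c _ ↦ summit_breatheFamily B d (c 0) hP⟩

end SelfWitness

section Relative

/-- **RELATIVE SETTLING: local settling kicks along MARGIN curves, plus the self-witnesses, give the
curve witnesses that the composition lemma `isTameChristodoulouGeneric_of_relative'` consumes.**
Hypothesis (the relative, local form of the line's stub 4): along every tame admissible curve `F` of
MARGIN data (told immersed-injective or constant) whose base `F 0` does NOT yet have the summit
property, there is a tame injective immersed admissible curve through `F 0` whose members with
`0 < ‖c‖ < ε₀` have it. Conclusion: the same without the restriction on the base and at every `c ≠ 0`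
(self-witness case by `summitSelfWitness`, kick case made global by the radial reparametrisation
`InitialDataSet.exists_tameCurve_of_local`). [folklore] -/
theorem summitCurveWitness_of_kick_and_self
    (hkick : ∀ (X : Type) [TopologicalSpace X] [ChartedSpace E3 X] [IsManifold (𝓡 3) ∞ X] [T2Space X]
      [SecondCountableTopology X] [ConnectedSpace X],
      ∀ (e : AFEnd X) (F : EuclideanSpace ℝ (Fin 1) → InitialDataSet (𝓡 3) X),
        InitialDataSet.IsTameDataFamily e 1 F →
          ((InitialDataSet.IsImmersedAtZero 1 F ∧ Function.Injective F) ∨ ∀ c, F c = F 0) →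
          (∀ c, F c ∈ admissibleVacuumData X) →
          (∀ c ≠ 0, (((∃ 𝒟 : VacuumCauchyDevelopment (F c), 𝒟.IsMaximal) ∧
              ∀ 𝒟 : VacuumCauchyDevelopment (F c), 𝒟.IsMaximal →
                HasCompleteNullInfinity 𝒟.toCauchyDevelopment) ∧
            ∀ 𝒟 : VacuumCauchyDevelopment (F c), 𝒟.IsMaximal →
              ∃ (N : ℕ) (m₀ χ : ℝ), 0 < m₀ ∧ 0 ≤ χ ∧ χ < 1 ∧
                ∀ (L : ℝ) (ε : ENNReal) (R₀ : ℝ), 0 < L → 0 < ε →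
                  𝒟.IsAdiabaticallyTracked N m₀ χ ε L R₀)) →
          ¬ ((∃ 𝒟 : VacuumCauchyDevelopment (F 0), 𝒟.IsMaximal) ∧
            ∀ 𝒟 : VacuumCauchyDevelopment (F 0), 𝒟.IsMaximal →
              HasCompleteNullInfinity 𝒟.toCauchyDevelopment ∧
                ∃ (O : Set 𝒟.carrier) (dd : FinalStateDecomposition 𝒟.toSpacetime O 2),
                  (∀ i, Kerr.IsSubextremal (dd.mass i) (dd.spin i)) ∧
                    O = exteriorOf 𝒟.toCauchyDevelopment dd.charted ∧
                      RaysStayInClosure 𝒟.toCauchyDevelopment O ∧ HasExhaustiveCharts dd ∧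
                        IsFutureOriented dd) →
          ∃ (e' : AFEnd X) (F' : EuclideanSpace ℝ (Fin 1) → InitialDataSet (𝓡 3) X),
            InitialDataSet.IsTameDataFamily e' 1 F' ∧ F' 0 = F 0 ∧ Function.Injective F' ∧
              InitialDataSet.IsImmersedAtZero 1 F' ∧ (∀ c, F' c ∈ admissibleVacuumData X) ∧
              ∃ ε₀ > (0 : ℝ), ∀ c : EuclideanSpace ℝ (Fin 1), c ≠ 0 → ‖c‖ < ε₀ →
                ((∃ 𝒟 : VacuumCauchyDevelopment (F' c), 𝒟.IsMaximal) ∧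
            ∀ 𝒟 : VacuumCauchyDevelopment (F' c), 𝒟.IsMaximal →
              HasCompleteNullInfinity 𝒟.toCauchyDevelopment ∧
                ∃ (O : Set 𝒟.carrier) (dd : FinalStateDecomposition 𝒟.toSpacetime O 2),
                  (∀ i, Kerr.IsSubextremal (dd.mass i) (dd.spin i)) ∧
                    O = exteriorOf 𝒟.toCauchyDevelopment dd.charted ∧
                      RaysStayInClosure 𝒟.toCauchyDevelopment O ∧ HasExhaustiveCharts dd ∧
                        IsFutureOriented dd)) :
    ∀ (X : Type) [TopologicalSpace X] [ChartedSpace E3 X] [IsManifold (𝓡 3) ∞ X] [T2Space X]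
      [SecondCountableTopology X] [ConnectedSpace X],
      ∀ (e : AFEnd X) (F : EuclideanSpace ℝ (Fin 1) → InitialDataSet (𝓡 3) X),
        InitialDataSet.IsTameDataFamily e 1 F →
          ((InitialDataSet.IsImmersedAtZero 1 F ∧ Function.Injective F) ∨ ∀ c, F c = F 0) →
          (∀ c, F c ∈ admissibleVacuumData X) →
          (∀ c ≠ 0, (((∃ 𝒟 : VacuumCauchyDevelopment (F c), 𝒟.IsMaximal) ∧
              ∀ 𝒟 : VacuumCauchyDevelopment (F c), 𝒟.IsMaximal →
                HasCompleteNullInfinity 𝒟.toCauchyDevelopment) ∧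
            ∀ 𝒟 : VacuumCauchyDevelopment (F c), 𝒟.IsMaximal →
              ∃ (N : ℕ) (m₀ χ : ℝ), 0 < m₀ ∧ 0 ≤ χ ∧ χ < 1 ∧
                ∀ (L : ℝ) (ε : ENNReal) (R₀ : ℝ), 0 < L → 0 < ε →
                  𝒟.IsAdiabaticallyTracked N m₀ χ ε L R₀)) →
          ∃ (e' : AFEnd X) (F' : EuclideanSpace ℝ (Fin 1) → InitialDataSet (𝓡 3) X),
            InitialDataSet.IsTameDataFamily e' 1 F' ∧ F' 0 = F 0 ∧ Function.Injective F' ∧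
              InitialDataSet.IsImmersedAtZero 1 F' ∧ (∀ c, F' c ∈ admissibleVacuumData X) ∧
              ∀ c : EuclideanSpace ℝ (Fin 1), c ≠ 0 →
                ((∃ 𝒟 : VacuumCauchyDevelopment (F' c), 𝒟.IsMaximal) ∧
            ∀ 𝒟 : VacuumCauchyDevelopment (F' c), 𝒟.IsMaximal →
              HasCompleteNullInfinity 𝒟.toCauchyDevelopment ∧
                ∃ (O : Set 𝒟.carrier) (dd : FinalStateDecomposition 𝒟.toSpacetime O 2),
                  (∀ i, Kerr.IsSubextremal (dd.mass i) (dd.spin i)) ∧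
                    O = exteriorOf 𝒟.toCauchyDevelopment dd.charted ∧
                      RaysStayInClosure 𝒟.toCauchyDevelopment O ∧ HasExhaustiveCharts dd ∧
                        IsFutureOriented dd) := by
  intro X _ _ _ _ _ _ e F hF hdich h𝓓 hQ
  by_cases hP : ((∃ 𝒟 : VacuumCauchyDevelopment (F 0), 𝒟.IsMaximal) ∧
            ∀ 𝒟 : VacuumCauchyDevelopment (F 0), 𝒟.IsMaximal →
              HasCompleteNullInfinity 𝒟.toCauchyDevelopment ∧
                ∃ (O : Set 𝒟.carrier) (dd : FinalStateDecomposition 𝒟.toSpacetime O 2),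
                  (∀ i, Kerr.IsSubextremal (dd.mass i) (dd.spin i)) ∧
                    O = exteriorOf 𝒟.toCauchyDevelopment dd.charted ∧
                      RaysStayInClosure 𝒟.toCauchyDevelopment O ∧ HasExhaustiveCharts dd ∧
                        IsFutureOriented dd)
  · obtain ⟨_, hsole, ⟨M, _, hSAF⟩, _⟩ := hF
    exact summitSelfWitness X e (F 0) (InitialDataSet.isTameDataFamily_const hsole 1 (hSAF 0)) (h𝓓 0) hP
  · obtain ⟨e', F', hF', h0, hinj, himm, h𝓓', ε₀, hε₀, hP'⟩ := hkick X e F hF hdich h𝓓 hQ hP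
    exact InitialDataSet.exists_tameCurve_of_local
      (P := fun D : InitialDataSet (𝓡 3) X ↦ ((∃ 𝒟 : VacuumCauchyDevelopment (D), 𝒟.IsMaximal) ∧
            ∀ 𝒟 : VacuumCauchyDevelopment (D), 𝒟.IsMaximal →
              HasCompleteNullInfinity 𝒟.toCauchyDevelopment ∧
                ∃ (O : Set 𝒟.carrier) (dd : FinalStateDecomposition 𝒟.toSpacetime O 2),
                  (∀ i, Kerr.IsSubextremal (dd.mass i) (dd.spin i)) ∧
                    O = exteriorOf 𝒟.toCauchyDevelopment dd.charted ∧
                      RaysStayInClosure 𝒟.toCauchyDevelopment O ∧ HasExhaustiveCharts dd ∧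
                        IsFutureOriented dd))
      hF' h0 hinj himm h𝓓' hε₀ hP'

/-- **THE SUMMIT FROM TAME-GENERIC MARGIN AND RELATIVE LOCAL SETTLING KICKS** (the relaxation of the
line's pointwise stub 4 that this file makes available): if MARGIN (censored; every MGHD tracked at
every accuracy with one complexity) is tame-Christodoulou-generic in the admissible class, and
settling kicks exist locally along margin curves (hypothesis of
`summitCurveWitness_of_kick_and_self`), then the re-typed `FinalStateConjecture` holds — one more
application of `isTameChristodoulouGeneric_of_relative'`. [folklore] -/
theorem finalStateConjecture_of_genericMargin_of_settlingKick
    (hM : ∀ (X : Type) [TopologicalSpace X] [ChartedSpace E3 X] [IsManifold (𝓡 3) ∞ X] [T2Space X]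
      [SecondCountableTopology X] [ConnectedSpace X],
      InitialDataSet.IsTameChristodoulouGeneric (admissibleVacuumData X)
        (fun D ↦ (((∃ 𝒟 : VacuumCauchyDevelopment (D), 𝒟.IsMaximal) ∧
              ∀ 𝒟 : VacuumCauchyDevelopment (D), 𝒟.IsMaximal →
                HasCompleteNullInfinity 𝒟.toCauchyDevelopment) ∧
            ∀ 𝒟 : VacuumCauchyDevelopment (D), 𝒟.IsMaximal →
              ∃ (N : ℕ) (m₀ χ : ℝ), 0 < m₀ ∧ 0 ≤ χ ∧ χ < 1 ∧
                ∀ (L : ℝ) (ε : ENNReal) (R₀ : ℝ), 0 < L → 0 < ε →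
                  𝒟.IsAdiabaticallyTracked N m₀ χ ε L R₀)) 1)
    (hkick : ∀ (X : Type) [TopologicalSpace X] [ChartedSpace E3 X] [IsManifold (𝓡 3) ∞ X] [T2Space X]
      [SecondCountableTopology X] [ConnectedSpace X],
      ∀ (e : AFEnd X) (F : EuclideanSpace ℝ (Fin 1) → InitialDataSet (𝓡 3) X),
        InitialDataSet.IsTameDataFamily e 1 F →
          ((InitialDataSet.IsImmersedAtZero 1 F ∧ Function.Injective F) ∨ ∀ c, F c = F 0) →
          (∀ c, F c ∈ admissibleVacuumData X) →
          (∀ c ≠ 0, (((∃ 𝒟 : VacuumCauchyDevelopment (F c), 𝒟.IsMaximal) ∧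
              ∀ 𝒟 : VacuumCauchyDevelopment (F c), 𝒟.IsMaximal →
                HasCompleteNullInfinity 𝒟.toCauchyDevelopment) ∧
            ∀ 𝒟 : VacuumCauchyDevelopment (F c), 𝒟.IsMaximal →
              ∃ (N : ℕ) (m₀ χ : ℝ), 0 < m₀ ∧ 0 ≤ χ ∧ χ < 1 ∧
                ∀ (L : ℝ) (ε : ENNReal) (R₀ : ℝ), 0 < L → 0 < ε →
                  𝒟.IsAdiabaticallyTracked N m₀ χ ε L R₀)) →
          ¬ ((∃ 𝒟 : VacuumCauchyDevelopment (F 0), 𝒟.IsMaximal) ∧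
            ∀ 𝒟 : VacuumCauchyDevelopment (F 0), 𝒟.IsMaximal →
              HasCompleteNullInfinity 𝒟.toCauchyDevelopment ∧
                ∃ (O : Set 𝒟.carrier) (dd : FinalStateDecomposition 𝒟.toSpacetime O 2),
                  (∀ i, Kerr.IsSubextremal (dd.mass i) (dd.spin i)) ∧
                    O = exteriorOf 𝒟.toCauchyDevelopment dd.charted ∧
                      RaysStayInClosure 𝒟.toCauchyDevelopment O ∧ HasExhaustiveCharts dd ∧
                        IsFutureOriented dd) →
          ∃ (e' : AFEnd X) (F' : EuclideanSpace ℝ (Fin 1) → InitialDataSet (𝓡 3) X),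
            InitialDataSet.IsTameDataFamily e' 1 F' ∧ F' 0 = F 0 ∧ Function.Injective F' ∧
              InitialDataSet.IsImmersedAtZero 1 F' ∧ (∀ c, F' c ∈ admissibleVacuumData X) ∧
              ∃ ε₀ > (0 : ℝ), ∀ c : EuclideanSpace ℝ (Fin 1), c ≠ 0 → ‖c‖ < ε₀ →
                ((∃ 𝒟 : VacuumCauchyDevelopment (F' c), 𝒟.IsMaximal) ∧
            ∀ 𝒟 : VacuumCauchyDevelopment (F' c), 𝒟.IsMaximal →
              HasCompleteNullInfinity 𝒟.toCauchyDevelopment ∧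
                ∃ (O : Set 𝒟.carrier) (dd : FinalStateDecomposition 𝒟.toSpacetime O 2),
                  (∀ i, Kerr.IsSubextremal (dd.mass i) (dd.spin i)) ∧
                    O = exteriorOf 𝒟.toCauchyDevelopment dd.charted ∧
                      RaysStayInClosure 𝒟.toCauchyDevelopment O ∧ HasExhaustiveCharts dd ∧
                        IsFutureOriented dd)) :
    _root_.FinalStateConjecture := by
  intro X _ _ _ _ _ _
  have h𝓓 : ∀ d ∈ admissibleVacuumData X,
      ∃ e : AFEnd X, e.IsSoleEnd ∧ ∃ M : ℝ, e.IsStronglyAsymptoticallyFlatDR d M :=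
    fun d hd ↦ exists_isSoleEnd_of_mem_admissibleVacuumData hd
  exact InitialDataSet.isTameChristodoulouGeneric_of_relative' h𝓓 (hM X)
    (summitCurveWitness_of_kick_and_self hkick X)

end Relative

end Summit.FinalStateConjecture.FinalStateConjecture.Theorems.PhaseMixingCaptureCaptureSufficesC2

end
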